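import Summits.QuantumFields.BalabanUV.Beta.GAN24.TaylorMassLam
import Summits.QuantumFields.BalabanUV.Beta.SymAveragingHessianCounts

/-!
# `TaylorMassLam` §4–§5 RE-RUN FOR an1's SYMMETRISED Hessian table `symHessFFAt (toSite r) Lc` (box root): support, entry bound, pointwise size and support of the
# lift, and the level-free ℓ¹ mass — the SAME constants as the rooted (ρ-a) `TaylorMassLamAt` and as the base module

NOT IN PRINT — OUR BOOKKEEPING (road-P2 = `b2b-balaban-gan24-p2` gen 56, 2026-08-25; row G-an2-4 ∕ (CONV-C), the (α-0) chain at row D1's literal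
OF RECORD (III′) `JsB12CombShSym`; [folklore] composition BY NAME; 0 `def`, 0 cite, 0 `def … : Prop`, 0 `sorry`).  Weight 0.  NEVER «G-an2-4 closed» as (CONV-C);
NOT D1, NOT BetaPertH, NOT continuum, NOT Clay; NO campaign opened (an2 W-4) — typed while idle under R-2 as the FIRST BRICK of the located `hUg-Λ` transfer
(road-P2 MEMO M-gan24p2-g56-1, `gen56/S-CAMPAIGN-SIZING-g56.v0_4.md` §2(a)).

METHOD = the OWNER gan24-p1's gen-6 `mkroot.py` rule applied to leaf-01 g60's (ρ-a) `TaylorMassLamAt`: the same theorem shapes with `hessFFAt (toSite r) Lc ↦ symHessFFAt (toSite r) Lc`,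
an1's sym support ∕ entry lemmas `SymAveragingHessianCounts.symHessKerAt_eq_zero_left ∕ _right` (support `Near`), `abs_symHessKerAt_le` (`≤ 2ℓ²` — «the SAME constant as the comb's»),
`symHessFFAt_inl_inl ∕ _inl_inr ∕ _inr` in place of the rooted ones; the root-free §1–§3 of the base `TaylorMassLam` (`abs_avgLift_inl_inl_le`, `exists_of_avgLift_ne_zero`,
`l1_sub_le_of_near`, `sum_abs_le_of_support`) BY NAME.  The proofs are leaf-01's, token for token.
* §1 **`symHessFFAt_ne_zero`** (a nonzero entry is field–field with both sites in `Near Lc y`), **`abs_avgLift_symHessFFAt_le`** (`|avgLift M (symHessFFAt (toSite r) Lc μ y) x w a b| ≤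
  2ℓ² ∕ M^{2(d+1)}`), **`avgLift_symHessFFAt_ne_zero`** (both fine legs within `ℓ¹`-distance `2(d+1)(Lc+1)·M` of `(M·Lc)•y`).
* §2 **`sum_abs_avgLift_symHessFFAt_le`** (`Σ_x Σ_w |…| ≤ (2R+1)^{2(d+1)}·2ℓ² ∕ M^{2(d+1)}`, `R = 2(d+1)(Lc+1)M`).
USE (located): the sym twins of (ρ-c) `TaylorRowLamInnerAt ∕ TableAt ∕ At`, (ρ-d) `TaylorRowLamTop*At`, `S3ShapeL0At`, `TaylorLamBracketAt`, `BornLambdaLift ∕ UndressedRow ∕ RowHolds`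
read these where the rooted rows read (ρ-a) — the `hUg-Λ` letter of road-P2's M.60 `CombBornLambdaSocket` at the sym table.  Discharges NOTHING by itself.
-/

noncomputable section

open Finset
open scoped BigOperators
open Literature.MathematicalPhysics.QuantumFieldTheory
open Literature.MathematicalPhysics.QuantumFieldTheory.Balaban1983to89
open Literature.MathematicalPhysics.QuantumFieldTheory.Balaban1983to89.Beta
open B12Sec2to5 (l1 l1_nonneg)
open ExpKernelCalculus (MKer l1_natSmul l1_sub_triangle)
open OneStepResolventKernel (Fib)
open InterLevelTransport (avgLift)
open AffineAveraging (box toSite)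
open AveragingHessianKernels (Near ell near_self l1_le_of_near)
open Summit.QuantumFields.BalabanUV.Beta.SymAveragingHessianCounts (symHessFFAt symHessKerAt symHessKerAt_eq_zero_left symHessKerAt_eq_zero_right abs_symHessKerAt_le
  symHessFFAt_inl_inl symHessFFAt_inl_inr symHessFFAt_inr)
open Summit.QuantumFields.BalabanUV.Beta.GAN24.TaylorMassLam (abs_avgLift_inl_inl_le exists_of_avgLift_ne_zero l1_sub_le_of_near sum_abs_le_of_support)

namespace Summit.QuantumFields.BalabanUV.Beta.GAN24.TaylorMassLamSymAt

variable {d : ℕ}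

/-! ## §1 an1's SYMMETRISED constraint Hessian and its lift: support and size -/

section Hessian

variable {Lc : ℕ} {r : Fin (d + 1) → ℕ}

/-- [folklore] SUPPORT OF an1's SYMMETRISED CONSTRAINT HESSIAN (box root): a nonzero entry of `symHessFFAt (toSite r) Lc μ y` is a field–field entry with both sites in the `Near` box
(`symHessKerAt_eq_zero_left ∕ _right`). -/
theorem symHessFFAt_ne_zero (hr : r ∈ box (d + 1) Lc) {μ : Fin (d + 1)} {y X W : Fin (d + 1) → ℤ} {a b : Fib d} (h : symHessFFAt (toSite r) Lc μ y X W a b ≠ 0) :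
    (∃ α α' : Fin (d + 1), a = Sum.inl α ∧ b = Sum.inl α') ∧ Near Lc y X ∧ Near Lc y W := by
  rcases a with α | ν
  · rcases b with α' | ν'
    · rw [symHessFFAt_inl_inl] at h
      refine ⟨⟨α, α', rfl, rfl⟩, ?_, ?_⟩
      · by_contra hX; exact h (symHessKerAt_eq_zero_left hr (f := (α, X)) hX _)
      · by_contra hW; exact h (symHessKerAt_eq_zero_right hr _ (f' := (α', W)) hW)
    · exact absurd (symHessFFAt_inl_inr (toSite r) Lc μ y X W α ν') h
  · exact absurd (symHessFFAt_inr (toSite r) Lc μ y X W ν b) h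

/-- [folklore] **SIZE — THE LIFTED SYMMETRISED CONSTRAINT HESSIAN IS `O(M^{−2(d+1)})` POINTWISE** (box root): `|avgLift M (symHessFFAt (toSite r) Lc μ y) x w a b| ≤ 2ℓ² ∕ M^{2(d+1)}`
(`abs_symHessKerAt_le` — the same `2ℓ²` as the comb's). -/
theorem abs_avgLift_symHessFFAt_le (M : ℕ) [NeZero M] (hL : 1 ≤ Lc) (hr : r ∈ box (d + 1) Lc) (μ : Fin (d + 1)) (y x w : Fin (d + 1) → ℤ) (a b : Fib d) :
    |avgLift M (symHessFFAt (toSite r) Lc μ y) x w a b| ≤ 2 * (ell (d + 1) Lc : ℝ) ^ 2 / (M : ℝ) ^ (2 * (d + 1)) := by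
  have h0 : (0 : ℝ) ≤ 2 * (ell (d + 1) Lc : ℝ) ^ 2 / (M : ℝ) ^ (2 * (d + 1)) := by positivity
  rcases a with α | ν
  · rcases b with α' | ν'
    · exact abs_avgLift_inl_inl_le M (symHessFFAt (toSite r) Lc μ y) α α'
        (fun X W => by rw [symHessFFAt_inl_inl]; exact abs_symHessKerAt_le hL μ y hr _ _) x w
    · -- the (inl, inr) block of `symHessFFAt` vanishes identically, hence so does its lift
      have hz : avgLift M (symHessFFAt (toSite r) Lc μ y) x w (Sum.inl α) (Sum.inr ν') = 0 := by
        by_contra hne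
        obtain ⟨X, W, hG, -, -⟩ := exists_of_avgLift_ne_zero M (symHessFFAt (toSite r) Lc μ y) hne
        exact hG (symHessFFAt_inl_inr (toSite r) Lc μ y X W α ν')
      rw [hz, abs_zero]; exact h0
  · have hz : avgLift M (symHessFFAt (toSite r) Lc μ y) x w (Sum.inr ν) b = 0 := by
      by_contra hne
      obtain ⟨X, W, hG, -, -⟩ := exists_of_avgLift_ne_zero M (symHessFFAt (toSite r) Lc μ y) hne
      exact hG (symHessFFAt_inr (toSite r) Lc μ y X W ν b)
    rw [hz, abs_zero]; exact h0

/-- [folklore] **SUPPORT OF THE LIFT** (box root): a nonzero entry of `avgLift M (symHessFFAt (toSite r) Lc μ y)` has both fine legs within `ℓ¹`-distance `2(d+1)(Lc+1)·M` of the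
fine image `(M·Lc)•y` of its coarse bond. -/
theorem avgLift_symHessFFAt_ne_zero (M : ℕ) [NeZero M] (hL : 1 ≤ Lc) (hr : r ∈ box (d + 1) Lc) {μ : Fin (d + 1)} {y x w : Fin (d + 1) → ℤ} {a b : Fib d}
    (h : avgLift M (symHessFFAt (toSite r) Lc μ y) x w a b ≠ 0) :
    l1 (x - ((M * Lc : ℕ) : ℤ) • y) ≤ 2 * ((d : ℝ) + 1) * (Lc + 1) * M ∧ l1 (w - ((M * Lc : ℕ) : ℤ) • y) ≤ 2 * ((d : ℝ) + 1) * (Lc + 1) * M := by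
  obtain ⟨X, W, hG, hx, hw⟩ := exists_of_avgLift_ne_zero M (symHessFFAt (toSite r) Lc μ y) h
  obtain ⟨-, hX, hW⟩ := symHessFFAt_ne_zero hr hG
  have hM : (0 : ℝ) ≤ M := Nat.cast_nonneg M
  have key : ∀ {v V : Fin (d + 1) → ℤ}, l1 (v - (M : ℤ) • V) ≤ 2 * (d + 1) * M → Near Lc y V →
      l1 (v - ((M * Lc : ℕ) : ℤ) • y) ≤ 2 * ((d : ℝ) + 1) * (Lc + 1) * M := by
    intro v V hv hV
    have h1 : l1 ((M : ℤ) • V - ((M * Lc : ℕ) : ℤ) • y) = (M : ℝ) * l1 (V - (Lc : ℤ) • y) := by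
      rw [← l1_natSmul, smul_sub, smul_smul]; push_cast; rfl
    have h2 := l1_sub_le_of_near hL hV
    have tri := l1_sub_triangle v ((M : ℤ) • V) (((M * Lc : ℕ) : ℤ) • y)
    rw [h1] at tri
    have h3 : (M : ℝ) * l1 (V - (Lc : ℤ) • y) ≤ (M : ℝ) * (2 * ((d : ℝ) + 1) * Lc) := mul_le_mul_of_nonneg_left h2 hM
    have h4 : (2 : ℝ) * (d + 1) * M + M * (2 * ((d : ℝ) + 1) * Lc) = 2 * ((d : ℝ) + 1) * (Lc + 1) * M := by ring
    linarith
  exact ⟨key hx hX, key hw hW⟩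

end Hessian

/-! ## §2 The level-free ℓ¹ mass of the lifted symmetrised Hessian -/

section Mass

variable {Lc : ℕ} {r : Fin (d + 1) → ℕ}

/-- [folklore] **MASS** (box root): over any finite sets of fine points `Σ_x Σ_w |avgLift M (symHessFFAt (toSite r) Lc μ y) x w a b| ≤ (2R+1)^{2(d+1)}·2ℓ² ∕ M^{2(d+1)}`,
`R = 2(d+1)(Lc+1)M` — the SAME as (ρ-a)'s and the base module's. -/
theorem sum_abs_avgLift_symHessFFAt_le (M : ℕ) [NeZero M] (hL : 1 ≤ Lc) (hr : r ∈ box (d + 1) Lc) (μ : Fin (d + 1)) (y : Fin (d + 1) → ℤ) (a b : Fib d)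
    (S T : Finset (Fin (d + 1) → ℤ)) :
    ∑ x ∈ S, ∑ w ∈ T, |avgLift M (symHessFFAt (toSite r) Lc μ y) x w a b| ≤
      ((2 * (2 * (d + 1) * (Lc + 1) * M) + 1) ^ (d + 1) : ℕ) * ((2 * (2 * (d + 1) * (Lc + 1) * M) + 1) ^ (d + 1) : ℕ) *
        (2 * (ell (d + 1) Lc : ℝ) ^ 2 / (M : ℝ) ^ (2 * (d + 1))) := by
  refine sum_abs_le_of_support (fun x w => avgLift M (symHessFFAt (toSite r) Lc μ y) x w a b) (((M * Lc : ℕ) : ℤ) • y) (2 * (d + 1) * (Lc + 1) * M)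
    (by positivity) (fun x w hne => ?_) (fun x w => abs_avgLift_symHessFFAt_le M hL hr μ y x w a b)
  have h := avgLift_symHessFFAt_ne_zero M hL hr hne
  have e : ((2 * (d + 1) * (Lc + 1) * M : ℕ) : ℝ) = 2 * ((d : ℝ) + 1) * (Lc + 1) * M := by push_cast; ring
  rw [e]
  exact h

end Mass

end Summit.QuantumFields.BalabanUV.Beta.GAN24.TaylorMassLamSymAt

end
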